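import Summits.ABC.IUTFork.Conditional.AbcOfSHvolAdmissibleWindowContent
import HarnessLib

/-!
# Branch C, TARGET #1: the LINE-OF-RECORD CONE binder `hreg` (v4 `abc_of_S_v4` = v5K/v6K/v7K `abc_of_SH_v6K`, byte-identical)
# on the admissible degree-2 family with the prime in print's (P1) window — the explicit Szpiro-type content, BY NAME
# (abc-iut cell, R2 S-chain team, seat abc-iut-s2-p3 gen 2; sequel of `AbcOfSHvolAdmissibleWindowContent`)

Record-only PROOF file (D-0012) of the abc-iut cell; TAKES NO SIDE on [IUTchIII] Cor. 3.12 or [IUTchIV] Thm. 1.10.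
S. Mochizuki, *IUT IV* [Mochizuki2012], Cor. 2.2 (ii) proof (P1)–(P7) pp. 44–46; Thm. 1.10 Steps (v), (viii) pp. 27–29.
[claim: Mochizuki2012, status: disputed] for every IUT quotation; the content of THIS file is one composition.

The S_H line of record `Conditional.abc_of_SH_v6K` (p437297; ≡ v7K p439097) carries the CONE binder `hreg` — v4's
(`Conditional.abc_of_S_v4`, p431657), byte-identical (abc-iut-s2-ref probes ProbeHregK / ProbeV6K): the hull estimate with
`B_III` demanded only at data OFF the slot-constant regime. `ThetaPartII.hullVolume_of_hullRegime` (abc-iut-c312-8/S3/S1, PROVED: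
slot-constant data and the (R4) term are theorems) gives `hreg ⟹ hvol`, so the two theorems of the parent files read `hreg`
VERBATIM:

* **`Conditional.splitDepthWindow_quadWitness_of_hreg`** — `hreg` ⟹ ∃ `k₀` ∀ `k ≥ k₀` ∃ prime `l ≥ 7`, `l ≠ 7`, with (P2), (P5), (P6)
  at `P_k = (ℚ(√2), 1/2 + 2/(3+√2)^k)` PROVED, `h_k^{1/2} ≤ l ≤ 10δ₂·h_k^{1/2}·log(2δ₂h_k)`, `k·log 2 ≤ h_k`,
  `(l+1)·k·log 7/48 ≤ B_III(P_k, l)` and `k·log 7/12 − E(l) ≤ (1+24/l)·(log-diff(P_k) + log-cond^{∤{2,l}}(λ_k))`;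
* **`Conditional.logCond_linear_lower_bound_of_hreg`** — `hreg` ⟹ ∃ `A B k₀` ∀ `k ≥ k₀` ∃ admissible `l`:
  `k·log 7/48 − 85·δ₂²·(A+Bk)^{1/2}·log(2δ₂(A+Bk)) − 13 ≤ log-diff(P_k) + log-cond^{∤{2,l}}(λ_k)`.

READING (neutral): every datum at `P_k` is off the slot-constant regime anyway (the prime `7` is MIXED: a bad and a non-bad place
of `ℚ(j(λ_k)) = ℚ(√2)` over it), so the regime clause of `hreg` costs nothing here; the line of record's CONE binder therefore
asserts the same effective abc/Szpiro-type bound on the explicit family, with every hypothesis of Cor. 2.2 (ii) discharged.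
HONEST SCOPE: consequences of the typed binder; typed ≠ proved; no side taken. PROOF-ONLY file: no definitions.
[cite: Mochizuki2012, IUTchIV Cor. 2.2 (ii) proof (P1)–(P7) p. 44–46] [cite: Mochizuki2012, IUTchIV Thm. 1.10 Steps (v)(viii) p. 27–29]
-/

noncomputable section

namespace Summit.ABC.IUTFork

open NumberField IsDedekindDomain Literature.IUT.LogVolume Literature.IUT.HodgeTheaters
open Literature.NumberTheory.DiophantineGeometry.GenEll
open scoped Classical

namespace Conditional

/-- **The line of record's CONE binder `hreg` on the admissible degree-2 family, prime in the (P1) window.** `hreg` VERBATIM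
(v4 p431657 = v6K p437297) ⟹ for all large `k` an ADMISSIBLE prime `l` at `P_k = (ℚ(√2), 1/2 + 2/(3+√2)^k)` ((P2), (P5), (P6)
PROVED) inside `h_k^{1/2} ≤ l ≤ 10δ₂·h_k^{1/2}·log(2δ₂h_k)` with `(l+1)·k·log 7/48 ≤ B_III(P_k, l)` and the divided form
`k·log 7/12 − E(l) ≤ (1+24/l)·(log-diff + log-cond)`. One composition: `ThetaPartII.hullVolume_of_hullRegime` (hreg ⟹ hvol) then
`splitDepthWindow_quadWitness_of_hvol`. Nothing asserted about any point or about print; no side taken.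
[cite: Mochizuki2012, IUTchIV Thm. 1.10 Step (v) p. 27–28] [claim: Mochizuki2012, status: disputed] -/
theorem splitDepthWindow_quadWitness_of_hreg
    (hreg : ∀ P : NFPoint, P ∈ UP → ∀ l : ℕ, l.Prime → 5 ≤ l →
      Cor22.AdmitsCore P → Cor22.CondP2 P l → Cor22.CondP5 P l → Cor22.CondP6 P l →
      ∀ T : Cor22.ThetaVolumeDatumAt P l,
        (letI := T.instFieldF; letI := T.instNumberFieldF; letI := T.instAlgebraF; letI := T.instFieldK
         letI := T.instNumberFieldK; letI := T.instAlgebraK; letI := T.instFieldFbar; letI := T.instAlgebraFbar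
         letI := T.instAlgebraKFbar; letI := T.instIsElliptic
         ¬ (∀ p ∈ T.I.supportPrimes, ∀ v w : placesOver (fieldOfModuli T.E) p,
            (Summit.ABC.IUTFork.DHData.ofInput T.I).logQloc p v = (Summit.ABC.IUTFork.DHData.ofInput T.I).logQloc p w)) →
        T.HullEstimateOf
          (((l : ℝ) + 1) / 4 *
            ((1 + 12 * (Cor22.dmod P : ℝ) / l) * (P.logDiff + Cor22.logCondAvoid P {2, l})
              + 2 * Real.log l + 52
              + 20 / 3 * Real.log (((2 ^ 12 * 3 ^ 3 * 5 * Cor22.dmod P : ℕ) : ℝ) * (l : ℝ))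
                * (Nat.primeCounting (2 ^ 12 * 3 ^ 3 * 5 * Cor22.dmod P * l) : ℝ)))) :
    ∃ k₀ : ℕ, ∀ k : ℕ, k₀ ≤ k →
      ∃ l : ℕ, l.Prime ∧ 7 ≤ l ∧ l ≠ 7 ∧ Cor22.CondP2 (QuadWitness.P k) l ∧ Cor22.CondP5 (QuadWitness.P k) l ∧
        Cor22.CondP6 (QuadWitness.P k) l ∧
        Real.sqrt (Cor22.logQForall (QuadWitness.P k)) ≤ l ∧
        (l : ℝ) ≤ 10 * Cor22.delta 2 * Real.sqrt (Cor22.logQForall (QuadWitness.P k)) *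
          Real.log (2 * Cor22.delta 2 * Cor22.logQForall (QuadWitness.P k)) ∧
        (k : ℝ) * Real.log 2 ≤ Cor22.logQForall (QuadWitness.P k) ∧
        ((l : ℝ) + 1) * k * Real.log 7 / 48 ≤
          ((l : ℝ) + 1) / 4 *
            ((1 + 24 / (l : ℝ)) * ((QuadWitness.P k).logDiff + Cor22.logCondAvoid (QuadWitness.P k) {2, l})
              + 2 * Real.log l + 52
              + 20 / 3 * Real.log (((2 ^ 13 * 3 ^ 3 * 5 : ℕ) : ℝ) * (l : ℝ))
                * (Nat.primeCounting (2 ^ 13 * 3 ^ 3 * 5 * l) : ℝ)) ∧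
        (k : ℝ) * Real.log 7 / 12
            - (2 * Real.log l + 52
              + 20 / 3 * Real.log (((2 ^ 13 * 3 ^ 3 * 5 : ℕ) : ℝ) * (l : ℝ))
                * (Nat.primeCounting (2 ^ 13 * 3 ^ 3 * 5 * l) : ℝ)) ≤
          (1 + 24 / (l : ℝ)) * ((QuadWitness.P k).logDiff + Cor22.logCondAvoid (QuadWitness.P k) {2, l}) :=
  splitDepthWindow_quadWitness_of_hvol (Summit.ABC.ABC.Theorems.ThetaPartII.hullVolume_of_hullRegime hreg)

/-- **The line of record's CONE binder ⟹ an effective Szpiro-type bound, linear in `k`, on the explicit admissible family.**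
`hreg` VERBATIM (v4 p431657 = v6K p437297) ⟹ ∃ `A, B ≥ 0`, `k₀` such that for every `k ≥ k₀` the point
`P_k = (ℚ(√2), 1/2 + 2/(3+√2)^k)` carries a prime `l ≥ 7` with (P2), (P5), (P6) PROVED and
`k·log 7/48 − 85·δ₂²·(A+Bk)^{1/2}·log(2δ₂(A+Bk)) − 13 ≤ log-diff(P_k) + log-cond^{∤{2,l}}(λ_k)` (`δ₂ = 2^13·3^3·5`).
One composition: `ThetaPartII.hullVolume_of_hullRegime` then `logCond_linear_lower_bound_of_hvol`. Nothing asserted about any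
point, about print, or about any author; no side taken on [IUTchIII] Cor. 3.12; typed ≠ proved.
[cite: Mochizuki2012, IUTchIV Cor. 2.2 (ii) proof (P1)–(P7) p. 44–46] [claim: Mochizuki2012, status: disputed] -/
theorem logCond_linear_lower_bound_of_hreg
    (hreg : ∀ P : NFPoint, P ∈ UP → ∀ l : ℕ, l.Prime → 5 ≤ l →
      Cor22.AdmitsCore P → Cor22.CondP2 P l → Cor22.CondP5 P l → Cor22.CondP6 P l →
      ∀ T : Cor22.ThetaVolumeDatumAt P l,
        (letI := T.instFieldF; letI := T.instNumberFieldF; letI := T.instAlgebraF; letI := T.instFieldK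
         letI := T.instNumberFieldK; letI := T.instAlgebraK; letI := T.instFieldFbar; letI := T.instAlgebraFbar
         letI := T.instAlgebraKFbar; letI := T.instIsElliptic
         ¬ (∀ p ∈ T.I.supportPrimes, ∀ v w : placesOver (fieldOfModuli T.E) p,
            (Summit.ABC.IUTFork.DHData.ofInput T.I).logQloc p v = (Summit.ABC.IUTFork.DHData.ofInput T.I).logQloc p w)) →
        T.HullEstimateOf
          (((l : ℝ) + 1) / 4 *
            ((1 + 12 * (Cor22.dmod P : ℝ) / l) * (P.logDiff + Cor22.logCondAvoid P {2, l})
              + 2 * Real.log l + 52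
              + 20 / 3 * Real.log (((2 ^ 12 * 3 ^ 3 * 5 * Cor22.dmod P : ℕ) : ℝ) * (l : ℝ))
                * (Nat.primeCounting (2 ^ 12 * 3 ^ 3 * 5 * Cor22.dmod P * l) : ℝ)))) :
    ∃ (A B : ℝ) (k₀ : ℕ), 0 ≤ A ∧ 0 ≤ B ∧ ∀ k : ℕ, k₀ ≤ k →
      ∃ l : ℕ, l.Prime ∧ 7 ≤ l ∧ Cor22.CondP2 (QuadWitness.P k) l ∧ Cor22.CondP5 (QuadWitness.P k) l ∧
        Cor22.CondP6 (QuadWitness.P k) l ∧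
        (k : ℝ) * Real.log 7 / 48 - 85 * Cor22.delta 2 ^ 2 * Real.sqrt (A + B * k) * Real.log (2 * Cor22.delta 2 * (A + B * k))
            - 13 ≤
          (QuadWitness.P k).logDiff + Cor22.logCondAvoid (QuadWitness.P k) {2, l} :=
  logCond_linear_lower_bound_of_hvol (Summit.ABC.ABC.Theorems.ThetaPartII.hullVolume_of_hullRegime hreg)

end Conditional

end Summit.ABC.IUTFork

end
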